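import Mathlib.RingTheory.Nullstellensatz
import Mathlib.RingTheory.KrullDimension.Basic
import Mathlib.Analysis.SpecialFunctions.Sqrt
import Mathlib.Analysis.SpecialFunctions.Pow.Real
import Mathlib.Data.Real.Basic
import Mathlib.Data.Set.Finite.Basic
import HarnessLib

/-!
# Finiteness of planar central configurations for four and five bodies (Albouy–Kaloshin 2012)

Topic `Literature/Dynamics/NBody`. NAMED FACTS only (D-0014), no proofs: the statements of
[AlbouyKaloshin2012] (Ann. of Math. 176 (2012) 535–588) that the `pub-smale6` cell certifies
against — Theorem 1 (Hampton–Moeckel, `n = 4`), Theorem 2 (`n = 5` outside a codimension-2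
closed algebraic subset `A` of the mass space) and the Example on p. 583 (the explicit 5-tuple
`(1,2,3,4,5)`). Everything is typed over the paper's own objects (pp. 535–536):

* System (1): `q_k = f_k := Σ_{l ≠ k} m_l r_{kl}^{-3} (q_k − q_l)`, `q_k = (x_k, y_k) ∈ ℝ²`,
  `r_{kl} = ((x_l − x_k)² + (y_l − y_k)²)^{1/2} > 0` (this is a central configuration with
  Laplace's `λ` rescaled to `1`, p. 536 l. 12–14).
* Definition 1 (p. 536): "A positive normalized central configuration of the planar `n`-body
  problem is a solution of (1) satisfying `y_{12} = 0`" (`y_{12} = y_2 − y_1`; the rotation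
  freedom is removed by that condition). "Positive" = real positive: real coordinates and
  `r_{kl} > 0`, i.e. the bodies are pairwise distinct — `hdist` below.
* Theorem 1 (Hampton, Moeckel), p. 536: "Let `n = 4`. For any choice of positive masses
  `m_1, …, m_4`, there are finitely many positive normalized central configurations."
* Theorem 2, p. 536: "For any choice of masses `(m_1, …, m_5) ∈ (ℝ⁺₀)⁵ \ A`, where `ℝ⁺₀` is
  the set of positive real numbers and `A` is a closed algebraic subset of codimension 2, there
  are finitely many positive normalized central configurations of the planar 5-body problem."
* Example, p. 583: "There are finitely many normalized central configurations with
  `m_1 = 1, m_2 = 2, m_3 = 3, m_4 = 4, m_5 = 5`."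

Encoding choices. Positions are `Fin n → ℝ × ℝ`; the Euclidean distance is written out
(`sqDist`, `Real.sqrt`) because Mathlib's `ℝ × ℝ` carries the sup metric. "Closed algebraic subset
of codimension 2" of `ℝ⁵` is rendered as: the real zero locus of an ideal of `ℝ[m_1,…,m_5]`
(`MvPolynomial.zeroLocus`) whose coordinate ring `ℝ[m]/I(A)` has Krull dimension `≤ 3`
(`IsClosedAlgebraicCodimGE2`); for real algebraic sets the dimension is the Krull dimension of the
coordinate ring (Bochnak–Coste–Roy, *Real Algebraic Geometry*, Prop. 2.8.2), so "codimension 2" is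
read as "codimension at least 2" — Albouy–Kaloshin's `A` is a finite union of sets each cut out by
two polynomial conditions with no common factor (p. 581–583, proof of Theorem 6), hence of
codimension at least 2 in this sense. The paper does NOT print the exceptional set `A`: it is
constructed procedurally in the proof of Theorem 6 (p. 581 l. 33 – p. 583 l. 3) from the mass
relations of §8 (several of the polynomials are given only by leading terms, e.g. "563 other
terms", p. 574), which is why the fact quantifies `A` existentially exactly as the theorem does.

Deliberately NOT here: Theorem 6 (finiteness of *complex* normalized central configurations,
Definition 2, p. 581), Theorems 3–5 (`n = 4` in the complex domain), the Bézout bound (p. 537),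
the individual mass relations (23), (29), (32), (36), (39), (40) of §8 — those belong to a
certificate-level file once the cell has recomputed them with two engines, and the spatial
`n = 5` theorem of Hampton–Jensen [HamptonJensen2011] (separate file).
Mathlib (this pin) has no central-configuration or `n`-body notions (searched
`[Cc]entral[Cc]onfig|nBody|NBody|relative equilibri`: nothing).
-/

namespace Literature.Dynamics.NBody

open MvPolynomial

/-- Squared Euclidean distance of two points of `ℝ × ℝ` (Mathlib's product metric is the sup
metric, so we spell the Euclidean one out): `r_{kl}² = (x_l − x_k)² + (y_l − y_k)²`. [folklore] -/
def sqDist (p q : ℝ × ℝ) : ℝ := (q.1 - p.1) ^ 2 + (q.2 - p.2) ^ 2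

/-- The right-hand side `f_k` of system (1) of [AlbouyKaloshin2012] p. 535:
`f_k = Σ_{l ≠ k} m_l r_{kl}^{-3} (q_k − q_l)` with `r_{kl} = sqrt(sqDist (q k) (q l))` — the display on
p. 535 reads `(x₁,y₁) = m₂ r₁₂⁻³ (x₂₁,y₂₁) + m₃ r₁₃⁻³ (x₃₁,y₃₁) + ⋯` with `x_kl = x_l − x_k`, and
"Newton's equations … are the 3-dimensional version of `q̈_k = −f_k`" (p. 535), so `f_k` is MINUS the
gravitational acceleration of body `k` (erratum 2026-08-18: revision 1 of this file, p178104, had the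
opposite sign `(q_l − q_k)`, which made `positiveNormalizedCCs m` empty for all positive `m` — every
body with extremal abscissa would have to sit at the origin — and the three facts below vacuous;
`positiveNormalizedCCs_fiveBodies_nonempty` now guards against that).
[cite: AlbouyKaloshin2012, system (1) p. 535] -/
noncomputable def newtonForce {n : ℕ} (m : Fin n → ℝ) (q : Fin n → ℝ × ℝ) (k : Fin n) : ℝ × ℝ :=
  ∑ l ∈ Finset.univ.erase k, (m l / Real.sqrt (sqDist (q k) (q l)) ^ 3) • (q k - q l)

/-- A **positive normalized central configuration** of the planar `n`-body problem with masses
`m` ([AlbouyKaloshin2012] Definition 1, p. 536; bodies numbered `0, …, n−1` here, the paper's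
`1, …, n`): a real configuration with pairwise distinct positions (`r_{kl} > 0`) solving system
(1), `q_k = f_k` for all `k`, and normalized by `y_{12} = 0`, i.e. `(q 1).2 = (q 0).2`.
[cite: AlbouyKaloshin2012, Definition 1 p. 536] -/
def IsPositiveNormalizedCC {n : ℕ} (m : Fin n → ℝ) (q : Fin n → ℝ × ℝ) : Prop :=
  (∀ k l : Fin n, k ≠ l → q k ≠ q l) ∧
  (∀ k : Fin n, q k = newtonForce m q k) ∧
  (∀ h0 : 0 < n, ∀ h1 : 1 < n, (q ⟨1, h1⟩).2 = (q ⟨0, h0⟩).2)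

/-- The set of positive normalized central configurations for the mass vector `m`.
[cite: AlbouyKaloshin2012, Definition 1 p. 536] -/
def positiveNormalizedCCs {n : ℕ} (m : Fin n → ℝ) : Set (Fin n → ℝ × ℝ) :=
  {q | IsPositiveNormalizedCC m q}

/-- A subset `A ⊆ ℝ^σ` is a *closed algebraic subset of codimension at least 2*: it is the real
zero locus of an ideal of `ℝ[X_σ]`, and its coordinate ring `ℝ[X_σ]/I(A)` has Krull dimension
`≤ |σ| − 2` (the dimension of a real algebraic set equals the Krull dimension of its coordinate
ring, Bochnak–Coste–Roy Prop. 2.8.2). Used with `σ = Fin 5`, bound `3`. [folklore] -/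
def IsClosedAlgebraicCodimGE2 {σ : Type*} [Fintype σ] (A : Set (σ → ℝ)) : Prop :=
  (∃ I : Ideal (MvPolynomial σ ℝ), A = zeroLocus ℝ I) ∧
  ringKrullDim (MvPolynomial σ ℝ ⧸ vanishingIdeal ℝ A) ≤ (Fintype.card σ - 2 : ℕ)

/-- **Theorem 1 (Hampton, Moeckel)** as stated in [AlbouyKaloshin2012] p. 536: for `n = 4` and
any positive masses `m_1, …, m_4` there are finitely many positive normalized central
configurations. Original proof: [HamptonMoeckel2005] (BKK / mixed volumes); Albouy–Kaloshin give a
computation-free proof (their Theorem 5, p. 563).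
[cite: AlbouyKaloshin2012, Theorem 1 p. 536] -/
def albouyKaloshin2012_theorem1_fourBodies : Prop :=
  ∀ m : Fin 4 → ℝ, (∀ k, 0 < m k) → (positiveNormalizedCCs m).Finite

/-- **Theorem 2** of [AlbouyKaloshin2012] p. 536, verbatim: "For any choice of masses
`(m_1, …, m_5) ∈ (ℝ⁺₀)⁵ \ A`, where `ℝ⁺₀` is the set of positive real numbers and `A` is a closed
algebraic subset of codimension 2, there are finitely many positive normalized central
configurations of the planar 5-body problem." The set `A` is the one constructed in the proof of
Theorem 6 (pp. 581–583) and is not printed in closed form; the statement therefore quantifies it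
existentially. [cite: AlbouyKaloshin2012, Theorem 2 p. 536] -/
def albouyKaloshin2012_theorem2_fiveBodies : Prop :=
  ∃ A : Set (Fin 5 → ℝ), IsClosedAlgebraicCodimGE2 A ∧
    ∀ m : Fin 5 → ℝ, (∀ k, 0 < m k) → m ∉ A → (positiveNormalizedCCs m).Finite

/-- The mass 5-tuple `(1, 2, 3, 4, 5)` of the Example on [AlbouyKaloshin2012] p. 583.
[cite: AlbouyKaloshin2012, Example p. 583] -/
def exampleMasses12345 : Fin 5 → ℝ := ![1, 2, 3, 4, 5]

/-- **Example**, [AlbouyKaloshin2012] p. 583: "There are finitely many normalized central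
configurations with `m_1 = 1, m_2 = 2, m_3 = 3, m_4 = 4, m_5 = 5`" (proof there: none of the mass
relations of §8 holds for these masses under any renumbering; Remark 7 explains how such a check
avoids the big polynomials). This is the paper's own explicit instance of a mass vector outside
`A`. [cite: AlbouyKaloshin2012, Example p. 583] -/
def albouyKaloshin2012_example12345 : Prop :=
  (positiveNormalizedCCs exampleMasses12345).Finite

/-! ### Non-vacuity guards (added with the sign erratum, 2026-08-18)

Collinear (Moulton) configurations are planar central configurations; for prescribed positions on
the `x`-axis system (1) is LINEAR in the masses, which gives exact rational witnesses. -/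

/-- `Real.sqrt b = a` when `b = a²`, `a ≥ 0` (to evaluate `√1, √4, √9, √16`). [folklore] -/
theorem sqrt_eq_of_eq_sq {a : ℝ} (ha : 0 ≤ a) (b : ℝ) (h : b = a ^ 2) : Real.sqrt b = a := by
  rw [h, Real.sqrt_sq ha]

/-- Witness positions for `n = 4`: abscissae `−3, −2, −1, 1` on the `x`-axis (a Moulton collinear
configuration). [folklore] -/
def witnessPos4 : Fin 4 → ℝ × ℝ := ![((-3 : ℝ), (0 : ℝ)), (-2, 0), (-1, 0), (1, 0)]
/-- Witness masses for `n = 4` (exact linear solve of system (1) at `witnessPos4`):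
`(88/41, 63/41, 114/41, 504/41)`. [folklore] -/
noncomputable def witnessMass4 : Fin 4 → ℝ := ![88/41, 63/41, 114/41, 504/41]

/-- Witness for `n = 4`: bodies at abscissae `−3, −2, −1, 1` with masses
`(88/41, 63/41, 114/41, 504/41)` form a positive normalized central configuration (system (1) with
`λ = 1`, `y₁₂ = 0`); in particular the fact `albouyKaloshin2012_theorem1_fourBodies` is not
vacuous (Moulton 1910 collinear configurations; exact rational arithmetic). [folklore] -/
theorem positiveNormalizedCCs_fourBodies_nonempty :
    witnessPos4 ∈ positiveNormalizedCCs witnessMass4 := by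
  have s1 : Real.sqrt 1 = 1 := Real.sqrt_one
  have s4 : Real.sqrt 4 = 2 := sqrt_eq_of_eq_sq (by norm_num) 4 (by norm_num)
  have s9 : Real.sqrt 9 = 3 := sqrt_eq_of_eq_sq (by norm_num) 9 (by norm_num)
  have s16 : Real.sqrt 16 = 4 := sqrt_eq_of_eq_sq (by norm_num) 16 (by norm_num)
  refine ⟨?_, ?_, ?_⟩
  · intro k l hkl
    fin_cases k <;> fin_cases l <;> simp [witnessPos4, Prod.ext_iff] at hkl ⊢ <;> norm_num
  · intro k
    rw [newtonForce, Finset.sum_erase_eq_sub (Finset.mem_univ k)]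
    fin_cases k <;> simp [witnessPos4, witnessMass4, Fin.sum_univ_four, sqDist, Prod.ext_iff] <;>
      norm_num [s1, s4, s9, s16]
  · intro h0 h1
    simp [witnessPos4]

/-- Witness positions for `n = 5`: abscissae `−2, −1, 0, 1, 2` on the `x`-axis (a Moulton collinear
configuration). [folklore] -/
def witnessPos5 : Fin 5 → ℝ × ℝ := ![((-2 : ℝ), (0 : ℝ)), (-1, 0), (0, 0), (1, 0), (2, 0)]
/-- Witness masses for `n = 5` (exact linear solve of system (1) at `witnessPos5`):
`(36/49, 72/49, 9/7, 72/49, 36/49)`. [folklore] -/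
noncomputable def witnessMass5 : Fin 5 → ℝ := ![36/49, 72/49, 9/7, 72/49, 36/49]

/-- Witness for `n = 5`: bodies at abscissae `−2, −1, 0, 1, 2` with the positive masses
`(36/49, 72/49, 9/7, 72/49, 36/49)` form a positive normalized central configuration; in particular
`positiveNormalizedCCs m ≠ ∅` for this positive `m`, so the `n = 5` facts above are not vacuous.
(Moulton 1910 collinear configurations; exact rational arithmetic.) [folklore] -/
theorem positiveNormalizedCCs_fiveBodies_nonempty :
    witnessPos5 ∈ positiveNormalizedCCs witnessMass5 := by
  have s1 : Real.sqrt 1 = 1 := Real.sqrt_one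
  have s4 : Real.sqrt 4 = 2 := sqrt_eq_of_eq_sq (by norm_num) 4 (by norm_num)
  have s9 : Real.sqrt 9 = 3 := sqrt_eq_of_eq_sq (by norm_num) 9 (by norm_num)
  have s16 : Real.sqrt 16 = 4 := sqrt_eq_of_eq_sq (by norm_num) 16 (by norm_num)
  refine ⟨?_, ?_, ?_⟩
  · intro k l hkl
    fin_cases k <;> fin_cases l <;> simp [witnessPos5, Prod.ext_iff] at hkl ⊢ <;> norm_num
  · intro k
    rw [newtonForce, Finset.sum_erase_eq_sub (Finset.mem_univ k)]
    fin_cases k <;> simp [witnessPos5, witnessMass5, Fin.sum_univ_five, sqDist, Prod.ext_iff] <;>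
      norm_num [s1, s4, s9, s16]
  · intro h0 h1
    simp [witnessPos5]

/-- The witness masses are positive (so the witnesses live in the regime of the facts). [folklore] -/
theorem witnessMass_pos : (∀ k, 0 < witnessMass4 k) ∧ (∀ k, 0 < witnessMass5 k) := by
  constructor <;> intro k <;> fin_cases k <;> simp [witnessMass4, witnessMass5]

end Literature.Dynamics.NBody
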